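import Literature.Computability.Learning.PAC
import Literature.Computability.MetaComplexity.NaturalProofs
import HarnessLib

/-!
# Steps towards `cikk_natural_implies_learning`: learning-side bridge lemmas

Fifth (small) instalment of the decomposition of the named fact
`Literature.Computability.Learning.cikk_natural_implies_learning` (Carmosino–Impagliazzo–Kabanets–Kolokolova, CCC 2016,
Thm. 5.1; `NaturalLearning.lean`). The combinatorial layers live in
`Literature/Computability/MetaComplexity/NWGenerator.lean` (designs, generator, hybrid argument),
`…/CIKKGenerator.lean` (the concrete generator and the size of its outputs),
`Literature/Computability/Cryptography/GoldreichLevin.lean` and `…/PairwiseSampling.lean`. This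
file collects the two bridges between those counting statements and the vocabulary of the fact:

* `errorProb_uniform_eq`, `one_sub_errorProb_toReal` — under the uniform distribution
  (`uniformDistributions`, `PMF.uniformOfFintype`) the PAC error `errorProb` of `PAC.lean`
  (an `ℝ≥0∞` outer-measure value) is the disagreement FRACTION, so `1 - errorProb` is the
  agreement fraction `#{x : h x = f x} / 2ⁿ` used by the reconstruction lemmas;
* `IsUsefulAgainstPPoly.exists_superpolynomial` — the tree's usefulness against every
  polynomial size (`IsUsefulAgainstPPoly`, per-length a.e. form) yields ONE superpolynomial
  size function `u` (`n^k ≤ u n` eventually, for every `k`) against which the property is useful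
  (`IsUsefulAgainstSize u`), i.e. the hypothesis "useful against `Λ[u]` for some `u = n^{ω(1)}`"
  of CIKK Thm. 5.1 in its third runtime regime (diagonalisation over the thresholds).

Everything is proved.

## References

* M. Carmosino, R. Impagliazzo, V. Kabanets, A. Kolokolova, *Learning algorithms from natural
  proofs*, CCC 2016, Thm. 5.1 and the runtime regimes listed after it
  [CarmosinoImpagliazzoKabanetsKolokolova2016].
* M. J. Kearns, U. V. Vazirani, *An Introduction to Computational Learning Theory*, 1994, §1.2
  (error of a hypothesis) [KearnsVazirani1994].
-/

open Finset Filter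

namespace Literature.Computability.Learning

/-- Under the uniform distribution the error probability is the fraction of disagreement
points. [folklore] -/
theorem errorProb_uniform_eq {n : ℕ} (h f : (Fin n → Bool) → Bool) :
    errorProb (PMF.uniformOfFintype (Fin n → Bool)) h f =
      ((univ.filter fun x : Fin n → Bool => h x ≠ f x).card : ENNReal) /
        Fintype.card (Fin n → Bool) := by
  classical
  unfold errorProb
  rw [PMF.toOuterMeasure_uniformOfFintype_apply]
  congr 1
  rw [Fintype.card_subtype]
  congr 2

/-- The agreement fraction `#{x : h x = f x} / 2ⁿ` is one minus the (real) error probability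
under the uniform distribution. [folklore] -/
theorem one_sub_errorProb_toReal {n : ℕ} (h f : (Fin n → Bool) → Bool) :
    1 - (errorProb (PMF.uniformOfFintype (Fin n → Bool)) h f).toReal =
      ((univ.filter fun x : Fin n → Bool => h x = f x).card : ℝ) /
        Fintype.card (Fin n → Bool) := by
  rw [errorProb_uniform_eq, ENNReal.toReal_div, ENNReal.toReal_natCast, ENNReal.toReal_natCast]
  have hc : (0 : ℝ) < Fintype.card (Fin n → Bool) := Nat.cast_pos.2 Fintype.card_pos
  have hsum := Finset.card_filter_add_card_filter_not (s := (univ : Finset (Fin n → Bool)))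
    (fun x => h x = f x)
  rw [card_univ] at hsum
  rw [eq_div_iff hc.ne', sub_mul, div_mul_cancel₀ _ hc.ne', one_mul]
  have : ((univ.filter fun x : Fin n → Bool => ¬ h x = f x).card : ℝ) =
      Fintype.card (Fin n → Bool) - (univ.filter fun x : Fin n → Bool => h x = f x).card := by
    rw [eq_sub_iff_add_eq, add_comm]; exact_mod_cast hsum
  simp only [ne_eq]
  linarith [this]

/-- The uniform-distribution error is at most `ε` iff the agreement fraction is at least
`1 - ε` (`0 ≤ ε`). [folklore] -/
theorem errorProb_uniform_le_iff {n : ℕ} (h f : (Fin n → Bool) → Bool) {ε : ℝ} (hε : 0 ≤ ε) :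
    errorProb (PMF.uniformOfFintype (Fin n → Bool)) h f ≤ ENNReal.ofReal ε ↔
      1 - ε ≤ ((univ.filter fun x : Fin n → Bool => h x = f x).card : ℝ) /
        Fintype.card (Fin n → Bool) := by
  rw [← one_sub_errorProb_toReal, sub_le_sub_iff_left]
  have hfin : errorProb (PMF.uniformOfFintype (Fin n → Bool)) h f ≠ ⊤ := by
    rw [errorProb_uniform_eq]
    exact ENNReal.div_ne_top (ENNReal.natCast_ne_top _)
      (Nat.cast_ne_zero.2 Fintype.card_pos.ne')
  rw [← ENNReal.ofReal_toReal hfin, ENNReal.ofReal_le_ofReal_iff hε, ENNReal.toReal_ofReal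
    ENNReal.toReal_nonneg]

end Literature.Computability.Learning

namespace Literature.Computability.Learning

open Complexity

/-- **Usefulness against `P/poly` is usefulness against ONE superpolynomial size bound**
(diagonalisation over the thresholds): if for every `k` the property is eventually useful
against size `n^k`, then there is a single `u` with `n^k ≤ u n` eventually for every `k` such
that the property is useful against size `u` — the hypothesis "useful against `Λ[u]` for some
size function `u`" of CIKK Thm. 5.1 in the regime `u = n^{ω(1)}`.
[cite: CarmosinoImpagliazzoKabanetsKolokolova2016, Thm. 5.1 (third runtime regime)] -/
theorem _root_.Literature.Computability.MetaComplexity.IsUsefulAgainstPPoly.exists_superpolynomial {R : MetaComplexity.CombinatorialProperty}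
    (h : MetaComplexity.IsUsefulAgainstPPoly R) :
    ∃ u : ℕ → ℕ, (∀ k, ∀ᶠ n in atTop, n ^ k ≤ u n) ∧ MetaComplexity.IsUsefulAgainstSize u R := by
  choose N hN using fun k => Filter.eventually_atTop.1 (h k)
  let K : ℕ → ℕ := fun n => ((range (n + 1)).filter fun k => N k ≤ n).sup id
  refine ⟨fun n => n ^ K n, fun k => ?_, ?_⟩
  · refine Filter.eventually_atTop.2 ⟨max (N k) (max k 1), fun n hn => ?_⟩
    have hk : k ≤ K n :=
      Finset.le_sup (f := id) (mem_filter.2 ⟨mem_range.2 (by omega), by omega⟩)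
    exact Nat.pow_le_pow_right (by omega) hk
  · refine Filter.eventually_atTop.2 ⟨N 0, fun n hn f hf => ?_⟩
    have hne : ((range (n + 1)).filter fun k => N k ≤ n).Nonempty :=
      ⟨0, mem_filter.2 ⟨mem_range.2 (by omega), hn⟩⟩
    obtain ⟨k', hk', hk'eq⟩ := Finset.exists_mem_eq_sup _ hne id
    have hNk' : N k' ≤ n := (mem_filter.1 hk').2
    have hlt := hN k' n hNk' f hf
    show n ^ K n < circuitSizeOver B2 f
    simp only [K, hk'eq, id]
    exact hlt

end Literature.Computability.Learning
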